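import Literature.Probability.RandomPlanarGeometry.SLETraceKappaLimit
import Literature.Probability.Process.BrownianScalingZeroOne
import HarnessLib

/-!
# Zero-one law for "SLE_κ is generated by a curve"

Topic `Probability/RandomPlanarGeometry`; theorems only (no new named fact). For every `κ` the
event that the chordal Loewner chain driven by `√κ B(ω)` is generated by a (continuous) curve,
`{ω | ∃ γ, Loewner.IsGeneratedByCurve (sleDriving κ ω) γ}` — the event whose almost-sureness is
the predicate `Literature.Probability.RandomPlanarGeometry.HasSLETrace κ` of `SLE.lean` — has
`preWienerMeasure`-probability **`0` or `1`**
(`Literature.Probability.RandomPlanarGeometry.measure_setOf_exists_isGeneratedByCurve_zero_or_one`).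
Hence the dichotomy `hasSLETrace_or_ae_not` (SLE_κ is either a.s. generated by a curve or a.s.
not), and the reduction **`HasSLETrace κ` ⇐ "generated by a curve with positive probability"**
(`hasSLETrace_of_frequently`, `hasSLETrace_iff_measure_ne_zero`), a route to the trace theorems
(Rohde–Schramm (2005), Thm. 5.1, `hasSLETrace_of_ne_eight`; Lawler–Schramm–Werner (2004),
Thm. 4.7, `hasSLETrace_eight`) that only asks for an event of positive probability.

Proof: the event is the preimage, under the Brownian path `ω ↦ B(ω)`, of a measurable set of
paths (the Borel set of continuous driving functions generated by a curve,
`measurableSet_snd_image_generatedPairs`, Lusin–Souslin on top of [LSW04] Lemma 3.14, pulled back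
to raw path space, `Process.borel_continuousMap_eq_iSup_comap_eval`), and this set is invariant
under Brownian scaling of the path because generating curves are dilation covariant
(`Loewner.IsGeneratedByCurve.scale`: the chain of `s ↦ a W(s / a²)` is generated by
`s ↦ a γ(s / a²)`; Rohde–Schramm (2005), Prop. 2.1 (i); Lawler (2005), §4.1 and Prop. 6.5). The
zero-one law for scale-invariant events of Brownian motion
(`IsPreBrownianReal.measure_zero_or_one_of_scaleInvariant`, `Process/BrownianScalingZeroOne.lean`:
"the scaling transformation of Brownian motion is ergodic", Chaumont–Yor (2003), Ex. 1.8)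
concludes.

## References

* S. Rohde, O. Schramm, *Basic properties of SLE*, Ann. of Math. 161 (2005), Prop. 2.1 (i)
  (scaling), Thm. 5.1.
* G. F. Lawler, *Conformally Invariant Processes in the Plane*, AMS (2005), §4.1, Prop. 6.5.
* L. Chaumont, M. Yor, *Exercises in Probability* (2003), Exercise 1.8, comment (b).
-/

noncomputable section

open Set Filter Topology MeasureTheory ProbabilityTheory
open scoped NNReal ENNReal

namespace Literature.Probability.RandomPlanarGeometry

open scoped PathBorel

section ZeroOne

variable (κ : ℝ≥0)

/-- **Brownian scaling of the generation event, pathwise.** For a sample path `ω`, `0 < c` and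
the rescaled Brownian path `t ↦ (√c)⁻¹ B_{ct}(ω)`: the Loewner chain of `√κ (√c)⁻¹ B_{c·}(ω)` is
generated by a curve iff the chain of `√κ B(ω)` is — both driving functions are Brownian-type
rescalings `s ↦ a W(s / a²)` of each other (`a = (√c)^{∓1}`), and generating curves are dilation
covariant (`Loewner.IsGeneratedByCurve.scale`). Rohde–Schramm (2005), Prop. 2.1 (i); Lawler
(2005), §4.1. [cite: RohdeSchramm2005, Prop. 2.1] -/
theorem exists_isGeneratedByCurve_smul_iff {c : ℝ≥0} (hc : 0 < c) (ω : ℝ≥0 → ℝ) :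
    (∃ γ, Loewner.IsGeneratedByCurve
        (fun t ↦ Real.sqrt κ * ((√c)⁻¹ * Process.brownian (c * t) ω)) γ) ↔
      ∃ γ, Loewner.IsGeneratedByCurve (sleDriving κ ω) γ := by
  set a : ℝ≥0 := (NNReal.sqrt c)⁻¹ with ha
  have hsc : NNReal.sqrt c ≠ 0 := fun h ↦ hc.ne' (NNReal.sqrt_eq_zero.1 h)
  have ha0 : a ≠ 0 := inv_ne_zero hsc
  have ha2 : a ^ 2 = c⁻¹ := by rw [ha, inv_pow, NNReal.sq_sqrt]
  have hacoe : (a : ℝ) = (√(c : ℝ))⁻¹ := by rw [ha, NNReal.coe_inv, Real.coe_sqrt]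
  have hsc' : √(c : ℝ) ≠ 0 := Real.sqrt_ne_zero'.2 (NNReal.coe_pos.2 hc)
  -- the rescaled driving function is `s ↦ a W(s / a²)`, `W = √κ B(ω)`
  have heq : (fun s ↦ (a : ℝ) * sleDriving κ ω (s / a ^ 2)) =
      fun t ↦ Real.sqrt κ * ((√c)⁻¹ * Process.brownian (c * t) ω) := by
    funext t
    rw [ha2, div_inv_eq_mul, mul_comm t c, sleDriving, hacoe]
    ring
  constructor
  · rintro ⟨γ, hγ⟩
    -- scale back by `a⁻¹ = √c`
    have h := hγ.scale (c := a⁻¹) (inv_ne_zero ha0)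
    refine ⟨_, (?_ : (fun s ↦ ((a⁻¹ : ℝ≥0) : ℝ) *
      (Real.sqrt κ * ((√c)⁻¹ * Process.brownian (c * (s / a⁻¹ ^ 2)) ω))) = sleDriving κ ω) ▸ h⟩
    funext s
    have h1 : a⁻¹ ^ 2 = c := by rw [inv_pow, ha2, inv_inv]
    have h2 : ((a⁻¹ : ℝ≥0) : ℝ) = √(c : ℝ) := by rw [NNReal.coe_inv, hacoe, inv_inv]
    rw [h1, mul_div_cancel₀ _ hc.ne', h2, sleDriving]
    field_simp
  · rintro ⟨γ, hγ⟩
    exact ⟨_, heq ▸ hγ.scale ha0⟩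

/-- **Zero-one law for the generation event of SLE_κ.** For every `κ`, the event that the chordal
Loewner chain driven by `√κ B(ω)` is generated by a curve has `preWienerMeasure`-probability `0`
or `1`: it is the preimage under the Brownian path of a measurable, scale-invariant set of paths
(`exists_isGeneratedByCurve_smul_iff`), and scale-invariant events of Brownian motion are trivial
(`IsPreBrownianReal.measure_zero_or_one_of_scaleInvariant`, ergodicity of Brownian scaling).
Rohde–Schramm (2005), Prop. 2.1 (i) with Chaumont–Yor (2003), Ex. 1.8 (b). [folklore] -/
theorem measure_setOf_exists_isGeneratedByCurve_zero_or_one :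
    Process.preWienerMeasure {ω | ∃ γ, Loewner.IsGeneratedByCurve (sleDriving κ ω) γ} = 0 ∨
      Process.preWienerMeasure {ω | ∃ γ, Loewner.IsGeneratedByCurve (sleDriving κ ω) γ} = 1 := by
  have hB : IsPreBrownianReal Process.brownian Process.preWienerMeasure :=
    (Process.isBrownianReal_brownian
      exists_isBrownianReal_measurable_continuous_holds').toIsPreBrownianReal
  -- the Borel set of continuous paths whose `√κ`-multiple is generated by a curve
  set T : Set C(ℝ≥0, ℝ) :=
    {F | ∃ γ, Loewner.IsGeneratedByCurve (fun t ↦ Real.sqrt κ * F t) γ} with hT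
  have hsm : Measurable fun F : C(ℝ≥0, ℝ) ↦ (Real.sqrt κ : ℝ) • F :=
    Process.measurable_continuousMap_of_eval fun t ↦
      (continuous_eval_const t).measurable.const_mul _
  have hTm : MeasurableSet T := by
    have h : T = (fun F : C(ℝ≥0, ℝ) ↦ (Real.sqrt κ : ℝ) • F) ⁻¹' (Prod.snd '' generatedPairs) := by
      ext F
      simp only [hT, mem_setOf_eq, mem_preimage, mem_image, Prod.exists, exists_eq_right,
        mem_generatedPairs, ContinuousMap.coe_smul]
      constructor
      · rintro ⟨γ, hγ⟩
        exact ⟨⟨γ, hγ.continuous⟩, hγ⟩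
      · rintro ⟨γ, hγ⟩
        exact ⟨γ, hγ⟩
    rw [h]
    exact hsm measurableSet_snd_image_generatedPairs
  -- pulled back to a measurable set `S` of raw paths
  have hle : (borel C(ℝ≥0, ℝ) : MeasurableSpace C(ℝ≥0, ℝ)) ≤
      MeasurableSpace.comap (fun (F : C(ℝ≥0, ℝ)) (t : ℝ≥0) ↦ F t) MeasurableSpace.pi := by
    rw [Process.borel_continuousMap_eq_iSup_comap_eval, Process.iSup_comap_eval_eq_comap_pi]
  obtain ⟨S, hS, hST⟩ := MeasurableSpace.measurableSet_comap.1 (hle _ hTm)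
  have hmemS : ∀ F : C(ℝ≥0, ℝ), (⇑F ∈ S ↔ F ∈ T) := fun F ↦ by rw [← hST]; rfl
  -- the generation event is the preimage of `S` under the Brownian path
  have hE : {ω | ∃ γ, Loewner.IsGeneratedByCurve (sleDriving κ ω) γ} =
      (fun ω t ↦ Process.brownian t ω) ⁻¹' S := by
    ext ω
    have h := hmemS ⟨fun t ↦ Process.brownian t ω, Process.continuous_brownian ω⟩
    simp only [ContinuousMap.coe_mk] at h
    rw [mem_preimage, h]
    rfl
  -- scale invariance of `S` along the (continuous) sample paths
  have hinv : ∀ c : ℝ≥0, 0 < c → c < 1 → ∀ ω,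
      (fun t ↦ (√c)⁻¹ * Process.brownian (c * t) ω) ∈ S ↔
        (fun t ↦ Process.brownian t ω) ∈ S := by
    intro c hc _ ω
    have hcont : Continuous fun t ↦ (√c)⁻¹ * Process.brownian (c * t) ω :=
      continuous_const.mul ((Process.continuous_brownian ω).comp (continuous_const.mul continuous_id))
    have h1 := hmemS ⟨fun t ↦ (√c)⁻¹ * Process.brownian (c * t) ω, hcont⟩
    have h2 := hmemS ⟨fun t ↦ Process.brownian t ω, Process.continuous_brownian ω⟩
    simp only [ContinuousMap.coe_mk] at h1 h2
    rw [h1, h2]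
    exact exists_isGeneratedByCurve_smul_iff κ hc ω
  rw [hE]
  exact hB.measure_zero_or_one_of_scaleInvariant Process.measurable_brownian
    Process.continuous_brownian (fun ω ↦ congrFun Process.brownian_zero ω) hS hinv

/-- **Dichotomy**: for every `κ`, SLE_κ is either almost surely generated by a curve
(`HasSLETrace κ`) or almost surely *not* generated by a curve. [folklore] -/
theorem hasSLETrace_or_ae_not :
    HasSLETrace κ ∨
      ∀ᵐ ω ∂Process.preWienerMeasure, ¬ ∃ γ, Loewner.IsGeneratedByCurve (sleDriving κ ω) γ := by
  rcases measure_setOf_exists_isGeneratedByCurve_zero_or_one κ with h | h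
  · right
    rw [ae_iff]
    simpa only [not_not] using h
  · left
    have hB : IsPreBrownianReal Process.brownian Process.preWienerMeasure :=
      (Process.isBrownianReal_brownian
        exists_isBrownianReal_measurable_continuous_holds').toIsPreBrownianReal
    haveI : IsProbabilityMeasure Process.preWienerMeasure :=
      hB.isGaussianProcess.isProbabilityMeasure
    change ∀ᵐ ω ∂Process.preWienerMeasure, ∃ γ, Loewner.IsGeneratedByCurve (sleDriving κ ω) γ
    rw [ae_iff, ← prob_compl_eq_zero_iff (measurableSet_setOf_exists_isGeneratedByCurve κ)] at *
    simpa only [compl_setOf] using h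

variable {κ}

/-- **SLE_κ is a.s. generated by a curve as soon as it is with positive probability**: if the
generation event is not null (`∃ᵐ ω`, i.e. positive `preWienerMeasure`), then `HasSLETrace κ`.
A reduction of the trace theorems (Rohde–Schramm (2005), Thm. 5.1; Lawler–Schramm–Werner
(2004), Thm. 4.7) to positive-probability statements, by the zero-one law
`measure_setOf_exists_isGeneratedByCurve_zero_or_one`. [folklore] -/
theorem hasSLETrace_of_frequently
    (h : ∃ᵐ ω ∂Process.preWienerMeasure, ∃ γ, Loewner.IsGeneratedByCurve (sleDriving κ ω) γ) :
    HasSLETrace κ := by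
  rcases hasSLETrace_or_ae_not κ with h1 | h1
  · exact h1
  · exact absurd h1 (frequently_ae_iff.1 h |> fun hne ↦ by
      rw [ae_iff]
      simpa only [not_not] using hne)

/-- `HasSLETrace κ` from a non-null generation event (measure form of
`hasSLETrace_of_frequently`). [folklore] -/
theorem hasSLETrace_of_measure_ne_zero
    (h : Process.preWienerMeasure {ω | ∃ γ, Loewner.IsGeneratedByCurve (sleDriving κ ω) γ} ≠ 0) :
    HasSLETrace κ :=
  hasSLETrace_of_frequently (frequently_ae_iff.2 h)

/-- **`HasSLETrace κ` iff the generation event has positive probability** (zero-one law).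
[folklore] -/
theorem hasSLETrace_iff_measure_ne_zero :
    HasSLETrace κ ↔
      Process.preWienerMeasure {ω | ∃ γ, Loewner.IsGeneratedByCurve (sleDriving κ ω) γ} ≠ 0 := by
  refine ⟨fun h h0 ↦ ?_, hasSLETrace_of_measure_ne_zero⟩
  have hB : IsPreBrownianReal Process.brownian Process.preWienerMeasure :=
    (Process.isBrownianReal_brownian
      exists_isBrownianReal_measurable_continuous_holds').toIsPreBrownianReal
  haveI : IsProbabilityMeasure Process.preWienerMeasure :=
    hB.isGaussianProcess.isProbabilityMeasure
  have h1 : Process.preWienerMeasure {ω | ∃ γ, Loewner.IsGeneratedByCurve (sleDriving κ ω) γ}ᶜ = 0 := by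
    have h' : ∀ᵐ ω ∂Process.preWienerMeasure, ∃ γ, Loewner.IsGeneratedByCurve (sleDriving κ ω) γ := h
    rw [ae_iff] at h'
    simpa only [compl_setOf] using h'
  have h2 := (prob_compl_eq_zero_iff (measurableSet_setOf_exists_isGeneratedByCurve κ)).1 h1
  rw [h0] at h2
  exact zero_ne_one h2

/-- `HasSLETrace κ` from a measurable event of positive probability on which the chain is
generated by a curve. [folklore] -/
theorem hasSLETrace_of_measure_ne_zero_of_subset {A : Set (ℝ≥0 → ℝ)}
    (hA : Process.preWienerMeasure A ≠ 0)
    (hgen : ∀ ω ∈ A, ∃ γ, Loewner.IsGeneratedByCurve (sleDriving κ ω) γ) : HasSLETrace κ :=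
  hasSLETrace_of_measure_ne_zero fun h0 ↦ hA (measure_mono_null (fun ω hω ↦ hgen ω hω) h0)

/-- **[LSW04] Thm. 4.7 from a positive-probability statement**: `hasSLETrace_eight` follows as
soon as the SLE₈ generation event is not null (zero-one law). [folklore] -/
theorem hasSLETrace_eight_of_measure_ne_zero
    (h : Process.preWienerMeasure
      {ω | ∃ γ, Loewner.IsGeneratedByCurve (sleDriving 8 ω) γ} ≠ 0) : hasSLETrace_eight :=
  hasSLETrace_of_measure_ne_zero h

/-- **Rohde–Schramm's Thm. 5.1 from positive-probability statements**: `hasSLETrace_of_ne_eight`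
follows as soon as, for every `κ ≠ 8`, the SLE_κ generation event is not null (zero-one law).
[folklore] -/
theorem hasSLETrace_of_ne_eight_of_forall_measure_ne_zero
    (h : ∀ κ : ℝ≥0, κ ≠ 8 → Process.preWienerMeasure
      {ω | ∃ γ, Loewner.IsGeneratedByCurve (sleDriving κ ω) γ} ≠ 0) : hasSLETrace_of_ne_eight :=
  fun hκ ↦ hasSLETrace_of_measure_ne_zero (h _ hκ)

end ZeroOne

end Literature.Probability.RandomPlanarGeometry
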